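/-
Copyright: the b2b-balaban cell (near-miss cell 7), T⁴-continuum fan-out; row NE7b ROUND-2 swarm, seat
t4-ne7b-formalise-leaf-09 (gen 12) — rows S12o (v) ∕ S12q «THE COUPLING WINDOW DISPLAYED»: the census WINDOW COLUMN as
kernel numerals (standing default (i), journal l.19633).  Released under the licence of the surrounding project.
-/
import Summits.QuantumFields.BalabanUV.T4Continuum.Support.HistoryThetaConcaveNumerals
import Mathlib.Analysis.SpecialFunctions.Pow.Real

/-!
# The coupling window of the NE7b count at the census letters, as kernel numerals (rows S12o (v) ∕ S12q)

Summits-side support leaf of the T⁴-continuum cell (rung (B)+1 on a FINITE torus only; NOT infinite volume, NOT the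
mass gap, NOT the Clay statement; NOT a proof of the spine estimate NE7b).  Row NE7b, route «COUNT», smallness census of
the cell's OWN count.  TREE-FREE: imports the tree-free numerals leaf `HistoryThetaConcaveNumerals` (leaf-08 gen 11,
itself `Mathlib`-only) and `Mathlib.Analysis.SpecialFunctions.Pow.Real`; no `def`, no `Prop`-valued fact, nothing of
print asserted, no `[cite:]` tag.  [folklore] elementary real analysis (`Real.exp_bound`, `Real.exp_one_lt_d9`,
`Real.exp_one_gt_d9`, `Real.pow_rpow_inv_natCast`) and `norm_num` arithmetic on explicit rationals.

WHY.  Row S12q (`HistoryRealiseCellsRunWindowT3bPc`, leaf-08 gen 12, p232166) DISPLAYS the coupling window of the pinned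
END as the hypothesis shape `g ≤ min (min 1 e^{−irThresholdTLE∕2}) (exp (−(max 1 ((Θ ∕ (θ·A₀)) ^ (p₀ : ℝ)⁻¹) + 1) ∕ 2))`,
`Θ = ΘJc + 8·2^d·log(2d+1)` written out; the census of record (11n′) ∕ R-OWNER-23-17∕-18 quote the SECOND factor as
«≈ 0.31 at p₀ = 23, ≈ 2.3·10⁻⁷ at p₀ = 2 (θ·A₀ := 1)».  The kernel numerals of `HistoryThetaConcaveNumerals` stop one step
short of it (`thetaJc_le : Θ ≤ 912.6`, `rootLevel_Jc_le : 912.6^{1∕23} ≤ 1.345`; the exponential was left to the engines).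
This file supplies the last step, two-sided, and the first-factor figures of leaf-01 gen 11's root-road note (journal
l.19771), so that every window figure quoted in the census is a kernel inequality.

WHAT.  §1 certificates in `norm_num`-decidable shape (`exp_le_taylor`∕`taylor_le_exp`: `S₅(r) ∓ r⁵∕100` encloses
`exp r` on `[0,1]`; `exp_le_of_taylor`∕`le_exp_of_taylor` at `x = n + r`; `le_log_of_pow_mul_le` = lower twin of leaf-08 g11's
`log_le_of_le_pow_mul`; `rpow_inv_le_of_le_pow`∕`le_rpow_inv_of_pow_le`).  §2 letter-free: the displayed factor
`w(Θ, a, p) = exp (−(max 1 ((Θ∕a)^{p⁻¹}) + 1)∕2)` is `≤ e⁻¹ ≤ 0.3679` for ALL letters and antitone in `Θ`.  §3 p₀ = 23 at the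
written-out LANDED constant of `thetaJc_le` (d = 4, collar 32 ⇒ rad 1122, sS = 34, θc₀ = 0.9799, θ·A₀ := 1):
**`thetaJc_ge : 912.51 ≤ Θ`**, **`window23_Jc : 0.3095 ≤ w(Θ,1,23) ≤ 0.3097`** (engines 0.3095998), `window23_concave_ge : 0.3098 ≤
w(Θ′,1,23)` for `Θ′ ≤ 874.7` (S12n's Jensen-form value `thetaConcave_le`).  §4 p₀ = 2: **`window2_Jc : 1.66·10⁻⁷ ≤ w(Θ,1,2) ≤
1.68·10⁻⁷`** (engines 1.6723·10⁻⁷), `window2_concave_ge : 2.29·10⁻⁷ ≤ w(Θ′,1,2)` for `Θ′ ≤ 874.7` — the quoted «2.3·10⁻⁷» is the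
Jensen-form figure; at the LANDED `Θ ≈ 912.51` it is `1.67·10⁻⁷` (located numeral; nothing landed is false).  §5 tree line,
generic: `1.31·10²⁷ ≤ Θ ⇒ w(Θ,1,23) ≤ 3.2·10⁻⁴`.  §6 FIRST FACTOR on its explicit (root) road, generic: `13 ≤ x ⇒ e^{−x∕2} ≤
1.51·10⁻³`, `16.52 ≤ 13·14^{1∕11}`, `e^{−13·14^{1∕11}∕2} ≤ 2.6·10⁻⁴` — leaf-01 g11's witness-letter rows `E₂∕A₀ = 1∕14`, `= 1` of
the merger clause `x_pay ≥ L·(14E₂∕A₀)^{1∕11}` at L = 13 (journal l.19771).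

HONEST: arithmetic on OUR count's displayed window at illustrative parameter values (journal ∕ census use, trigger c6:
the symbolic theorems — S12q's window END p232166, the pinned END p224056, the headline of record p224237, the root
threshold p225123 — are UNCHANGED and not imported; no tree-importing file is specialised); a census, not an estimate of
print; nothing of H3 ∕ (B) ∕ BetaPertHyp discharged; NE7b NOT proved; spine 0∕9.  HONEST DEPENDENCY (cell): continuum YM
on T⁴ ⇐ BetaPertH ∧ nine spine estimates (0/9 proved); BetaPertH ⇐ (D1) ∧ (D4) ∧ CAP+tail; G-an2-4 gates asym, D1 and
NE2/3/4.  This file changes none of it.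
-/

namespace Summit.QuantumFields.BalabanUV.T4Continuum.HistoryWindowNumerals

open Finset
open Summit.QuantumFields.BalabanUV.T4Continuum.HistoryThetaConcaveNumerals

/-! ## §1 Reusable exponential ∕ logarithm ∕ root certificates -/

section Certificates
/-- **FIVE-TERM TAYLOR ENCLOSURE OF `exp` ON `[0, 1]`, upper half**:
`exp r ≤ 1 + r + r²∕2 + r³∕6 + r⁴∕24 + r⁵∕100` (`Real.exp_bound` with `n = 5`: tail `≤ r⁵·6∕(120·5)`). [folklore] -/
theorem exp_le_taylor {r : ℝ} (hr0 : 0 ≤ r) (hr1 : r ≤ 1) :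
    Real.exp r ≤ 1 + r + r ^ 2 / 2 + r ^ 3 / 6 + r ^ 4 / 24 + r ^ 5 / 100 := by
  have hx : |r| ≤ 1 := by rw [abs_of_nonneg hr0]; exact hr1
  have h := Real.exp_bound hx (n := 5) (by norm_num)
  rw [abs_of_nonneg hr0] at h
  have h2 := (abs_le.1 h).2
  norm_num [Finset.sum_range_succ, Nat.factorial] at h2
  nlinarith [h2]

/-- **FIVE-TERM TAYLOR ENCLOSURE OF `exp` ON `[0, 1]`, lower half**:
`1 + r + r²∕2 + r³∕6 + r⁴∕24 − r⁵∕100 ≤ exp r`. [folklore] -/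
theorem taylor_le_exp {r : ℝ} (hr0 : 0 ≤ r) (hr1 : r ≤ 1) :
    1 + r + r ^ 2 / 2 + r ^ 3 / 6 + r ^ 4 / 24 - r ^ 5 / 100 ≤ Real.exp r := by
  have hx : |r| ≤ 1 := by rw [abs_of_nonneg hr0]; exact hr1
  have h := Real.exp_bound hx (n := 5) (by norm_num)
  rw [abs_of_nonneg hr0] at h
  have h2 := (abs_le.1 h).1
  norm_num [Finset.sum_range_succ, Nat.factorial] at h2
  nlinarith [h2]

/-- **UPPER EXP CERTIFICATE**: `x = n + r`, `0 ≤ r ≤ 1` ⇒ `exp x ≤ 2.7182818286^n·(S₅(r) + r⁵∕100)`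
(`Real.exp_one_lt_d9`) — the shape in which `norm_num` decides an upper bound of an exponential. [folklore] -/
theorem exp_le_of_taylor {x r : ℝ} (n : ℕ) (hx : x = n + r) (hr0 : 0 ≤ r) (hr1 : r ≤ 1) :
    Real.exp x ≤ (2.7182818286 : ℝ) ^ n * (1 + r + r ^ 2 / 2 + r ^ 3 / 6 + r ^ 4 / 24 + r ^ 5 / 100) := by
  rw [hx, Real.exp_add]
  have he : Real.exp (n : ℝ) = Real.exp 1 ^ n := by rw [← Real.exp_nat_mul, mul_one]
  rw [he]
  refine mul_le_mul ?_ (exp_le_taylor hr0 hr1) (by positivity) (by positivity)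
  have he1 := Real.exp_one_lt_d9.le
  gcongr

/-- **LOWER EXP CERTIFICATE**: `x = n + r`, `0 ≤ r ≤ 1` ⇒ `2.7182818283^n·(S₅(r) − r⁵∕100) ≤ exp x`
(`Real.exp_one_gt_d9`). [folklore] -/
theorem le_exp_of_taylor {x r : ℝ} (n : ℕ) (hx : x = n + r) (hr0 : 0 ≤ r) (hr1 : r ≤ 1) :
    (2.7182818283 : ℝ) ^ n * (1 + r + r ^ 2 / 2 + r ^ 3 / 6 + r ^ 4 / 24 - r ^ 5 / 100) ≤ Real.exp x := by
  rw [hx, Real.exp_add]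
  have he : Real.exp (n : ℝ) = Real.exp 1 ^ n := by rw [← Real.exp_nat_mul, mul_one]
  rw [he]
  have hS : 0 ≤ 1 + r + r ^ 2 / 2 + r ^ 3 / 6 + r ^ 4 / 24 - r ^ 5 / 100 := by
    have : r ^ 5 ≤ 1 := pow_le_one₀ hr0 hr1
    nlinarith [pow_nonneg hr0 2, pow_nonneg hr0 3, pow_nonneg hr0 4]
  refine mul_le_mul ?_ (taylor_le_exp hr0 hr1) hS (by positivity)
  have he1 := Real.exp_one_gt_d9.le
  gcongr

/-- **LOWER LOG CERTIFICATE** (twin of `HistoryThetaConcaveNumerals.log_le_of_le_pow_mul`): `0 ≤ r ≤ 1`,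
`2.7182818286^n·(S₅(r) + r⁵∕100) ≤ x` ⇒ `n + r ≤ log x`. [folklore] -/
theorem le_log_of_pow_mul_le {x r : ℝ} (hr0 : 0 ≤ r) (hr1 : r ≤ 1) (n : ℕ)
    (h : (2.7182818286 : ℝ) ^ n * (1 + r + r ^ 2 / 2 + r ^ 3 / 6 + r ^ 4 / 24 + r ^ 5 / 100) ≤ x) :
    (n : ℝ) + r ≤ Real.log x := by
  have hpos : 0 < (2.7182818286 : ℝ) ^ n * (1 + r + r ^ 2 / 2 + r ^ 3 / 6 + r ^ 4 / 24 + r ^ 5 / 100) := by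
    positivity
  rw [Real.le_log_iff_exp_le (hpos.trans_le h)]
  exact (exp_le_of_taylor n rfl hr0 hr1).trans h

/-- **ROOT BELOW A DECIMAL**: `0 ≤ Θ ≤ b^p` (`0 ≤ b`, `p ≠ 0`) ⇒ `Θ^{p⁻¹} ≤ b` (`Real.pow_rpow_inv_natCast`). [folklore] -/
theorem rpow_inv_le_of_le_pow {Θ b : ℝ} {p : ℕ} (hp : p ≠ 0) (hb : 0 ≤ b) (hΘ : 0 ≤ Θ) (h : Θ ≤ b ^ p) :
    Θ ^ ((p : ℝ)⁻¹) ≤ b := by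
  calc Θ ^ ((p : ℝ)⁻¹) ≤ (b ^ p) ^ ((p : ℝ)⁻¹) := Real.rpow_le_rpow hΘ h (by positivity)
    _ = b := Real.pow_rpow_inv_natCast hb hp

/-- **ROOT ABOVE A DECIMAL**: `b^p ≤ Θ` (`0 ≤ b`, `p ≠ 0`) ⇒ `b ≤ Θ^{p⁻¹}`. [folklore] -/
theorem le_rpow_inv_of_pow_le {Θ b : ℝ} {p : ℕ} (hp : p ≠ 0) (hb : 0 ≤ b) (h : b ^ p ≤ Θ) :
    b ≤ Θ ^ ((p : ℝ)⁻¹) := by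
  calc b = (b ^ p) ^ ((p : ℝ)⁻¹) := (Real.pow_rpow_inv_natCast hb hp).symm
    _ ≤ Θ ^ ((p : ℝ)⁻¹) := Real.rpow_le_rpow (by positivity) h (by positivity)

end Certificates

/-! ## §2 Letter-free facts about the displayed factor `w(Θ, a, p) = exp (−(max 1 ((Θ∕a)^{p⁻¹}) + 1)∕2)` -/

section Shape
/-- **THE DISPLAYED FACTOR NEVER EXCEEDS `e⁻¹`**, for all letters: `max 1 _ ≥ 1`. [folklore] -/
theorem windowFactor_le_exp_neg_one (Θ a q : ℝ) :
    Real.exp (-((max 1 ((Θ / a) ^ q)) + 1) / 2) ≤ Real.exp (-1) := by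
  refine Real.exp_le_exp.2 ?_
  have := le_max_left (1 : ℝ) ((Θ / a) ^ q)
  linarith

/-- `e⁻¹ ≤ 0.3679`; hence the road's displayed coupling window is below `0.3679` whatever the constants. [folklore] -/
theorem exp_neg_one_le : Real.exp (-1) ≤ 0.3679 := by
  rw [Real.exp_neg, inv_le_comm₀ (Real.exp_pos _) (by norm_num)]
  have h := Real.exp_one_gt_d9.le
  have : (1 / 0.3679 : ℝ) ≤ 2.7182818283 := by norm_num
  simpa [one_div] using this.trans h

/-- corollary: `w(Θ, a, q) ≤ 0.3679` for all letters [folklore] -/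
theorem windowFactor_le (Θ a q : ℝ) : Real.exp (-((max 1 ((Θ / a) ^ q)) + 1) / 2) ≤ 0.3679 :=
  (windowFactor_le_exp_neg_one Θ a q).trans exp_neg_one_le

/-- **ANTITONE IN `Θ`**: a larger entropy constant gives a smaller window (`0 ≤ Θ ≤ Θ′`, `0 < a`, `0 ≤ q`). [folklore] -/
theorem windowFactor_antitone {Θ Θ' a q : ℝ} (hΘ : 0 ≤ Θ) (h : Θ ≤ Θ') (ha : 0 < a) (hq : 0 ≤ q) :
    Real.exp (-((max 1 ((Θ' / a) ^ q)) + 1) / 2) ≤ Real.exp (-((max 1 ((Θ / a) ^ q)) + 1) / 2) := by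
  refine Real.exp_le_exp.2 ?_
  have h1 : (Θ / a) ^ q ≤ (Θ' / a) ^ q :=
    Real.rpow_le_rpow (div_nonneg hΘ ha.le) (div_le_div_of_nonneg_right h ha.le) hq
  have h2 : max 1 ((Θ / a) ^ q) ≤ max 1 ((Θ' / a) ^ q) := max_le_max le_rfl h1
  linarith

end Shape

/-! ## §3 The p₀ = 23 column at the landed constant (d = 4, c = 32, sS = 34, θc₀ = 0.9799, θ·A₀ := 1) -/

section Column23
/-- **`56.3224 ≤ log κM₀`** (engines: 56.32246; upper twin `log_kappaM0_le`: `≤ 56.3271`). [folklore] -/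
theorem le_log_kappaM0 : (56.3224 : ℝ) ≤ Real.log (193467494600870381979687500 / 67 : ℝ) := by
  have h := le_log_of_pow_mul_le (x := (193467494600870381979687500 / 67 : ℝ)) (r := 0.3224)
    (by norm_num) (by norm_num) 56 (by norm_num)
  norm_num at h
  linarith

/-- **`65.3796 ≤ log (2Ω(1+Cr)+1)`** (engines: 65.37965; upper twin `log_omegaArg_le`: `≤ 65.387`). [folklore] -/
theorem le_log_omegaArg : (65.3796 : ℝ) ≤ Real.log (1659951085422332076036609383777 / 67 : ℝ) := by
  have h := le_log_of_pow_mul_le (x := (1659951085422332076036609383777 / 67 : ℝ)) (r := 0.3796)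
    (by norm_num) (by norm_num) 65 (by norm_num)
  norm_num at h
  linarith

/-- **`2.197224 ≤ log 9`** (engines: 2.1972246; upper twin `log_nine_le`: `≤ 2.19725`). [folklore] -/
theorem le_log_nine : (2.197224 : ℝ) ≤ Real.log 9 := by
  have h := le_log_of_pow_mul_le (x := (9 : ℝ)) (r := 0.197224) (by norm_num) (by norm_num) 2 (by norm_num)
  norm_num at h
  linarith

/-- **THE LOWER NUMERAL OF THE LANDED CONSTANT: `912.51 ≤ ΘJc + 8·2^d·log(2d+1)`** at the tree's letters — the expression
of `thetaJc_le` token for token (engines: 912.5138916); so the kernel encloses the constant in `[912.51, 912.6]`. [folklore] -/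
theorem thetaJc_ge :
    (912.51 : ℝ) ≤
    ((1 + Real.log ((2 * (2 * 1122 + 1 : ℝ) ^ 4 * 65 ^ 4 * (4 * 2 ^ 4) + 4 * ((2 * 1122 + 1 : ℝ) ^ 4 * 5 ^ 4)) / (1 - 0.9799) +
          2 * (2 * ((2 * 1122 + 1 : ℝ) ^ 4 * 5 ^ 4))) +
        (0 + 3 * (2 * Real.log (2 * 4 + 1)) + 2 * (4 : ℝ) + 2 * Real.log (2 * 4 + 1) * (4 * 2 ^ 4) +
          (4 : ℝ) * Real.log (2 * ((66 * ((2 * (2 * 1122 + 1 : ℝ) ^ 4 * 65 ^ 4 * (4 * 2 ^ 4) + 4 * ((2 * 1122 + 1 : ℝ) ^ 4 * 5 ^ 4)) / (1 - 0.9799)) +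
            66 * (2 * ((2 * 1122 + 1 : ℝ) ^ 4 * 5 ^ 4)) + 1) * (1 + 4 * 2 ^ 4)) + 1)) +
        10) +
      8 * 2 ^ 4 * Real.log (2 * 4 + 1)) := by
  rw [kappaM0_eq, omegaArg_eq, show (2 * 4 + 1 : ℝ) = 9 by norm_num]
  have h1 := le_log_kappaM0
  have h2 := le_log_omegaArg
  have h3 := le_log_nine
  nlinarith

/-- **p₀ = 23, LOWER LINE**: `0 ≤ Θ ≤ 912.6` ⇒ `0.3095 ≤ w(Θ, 1, 23)` (`912.6 ≤ 1.345²³`; engines 0.30958). [folklore] -/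
theorem window23_ge_of_le {Θ : ℝ} (hΘ0 : 0 ≤ Θ) (hΘ : Θ ≤ 912.6) :
    (0.3095 : ℝ) ≤ Real.exp (-((max 1 ((Θ / 1) ^ ((23 : ℝ)⁻¹))) + 1) / 2) := by
  have hx : (Θ / 1) ^ ((23 : ℝ)⁻¹) ≤ 1.345 := by
    rw [div_one, show ((23 : ℝ)⁻¹) = ((23 : ℕ) : ℝ)⁻¹ by norm_num]
    exact rpow_inv_le_of_le_pow (by norm_num) (by norm_num) hΘ0 (hΘ.trans (by norm_num))
  have h := exp_le_of_taylor (x := (1.345 + 1 : ℝ) / 2) (r := 0.1725) 1 (by norm_num) (by norm_num) (by norm_num)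
  have hnum : (0.3095 : ℝ) ≤ Real.exp (-((1.345 + 1 : ℝ) / 2)) := by
    rw [Real.exp_neg, le_inv_comm₀ (by norm_num) (Real.exp_pos _)]
    norm_num at h ⊢
    linarith
  refine hnum.trans (Real.exp_le_exp.2 ?_)
  have : max 1 ((Θ / 1) ^ ((23 : ℝ)⁻¹)) ≤ 1.345 := max_le (by norm_num) hx
  linarith

/-- **p₀ = 23, UPPER LINE**: `912.51 ≤ Θ` ⇒ `w(Θ, 1, 23) ≤ 0.3097` (`1.3449²³ ≤ 912.51`; engines 0.30961). [folklore] -/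
theorem window23_le_of_ge {Θ : ℝ} (hΘ : 912.51 ≤ Θ) :
    Real.exp (-((max 1 ((Θ / 1) ^ ((23 : ℝ)⁻¹))) + 1) / 2) ≤ 0.3097 := by
  have hx : (1.3449 : ℝ) ≤ (Θ / 1) ^ ((23 : ℝ)⁻¹) := by
    rw [div_one, show ((23 : ℝ)⁻¹) = ((23 : ℕ) : ℝ)⁻¹ by norm_num]
    exact le_rpow_inv_of_pow_le (by norm_num) (by norm_num) (le_trans (by norm_num) hΘ)
  have h := le_exp_of_taylor (x := (1.3449 + 1 : ℝ) / 2) (r := 0.17245) 1 (by norm_num) (by norm_num) (by norm_num)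
  have hnum : Real.exp (-((1.3449 + 1 : ℝ) / 2)) ≤ 0.3097 := by
    rw [Real.exp_neg, inv_le_comm₀ (Real.exp_pos _) (by norm_num)]
    norm_num at h ⊢
    linarith
  refine (Real.exp_le_exp.2 ?_).trans hnum
  have : (1.3449 : ℝ) ≤ max 1 ((Θ / 1) ^ ((23 : ℝ)⁻¹)) := hx.trans (le_max_right _ _)
  linarith

/-- **THE p₀ = 23 WINDOW AT THE LANDED CONSTANT: `0.3095 ≤ w(ΘJc + 8·2⁴·log 9, 1, 23) ≤ 0.3097`** — S12q's displayed
second factor at `d = 4`, collar 32 (rad 1122), `sS = 34`, `θc₀ = 0.9799`, `θ·A₀ := 1`, `p₀ = 23`; the constant is the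
expression of `thetaJc_le` token for token (engines: 0.3095998). [folklore] -/
theorem window23_Jc :
    (0.3095 : ℝ) ≤ Real.exp (-((max 1 ((
    ((1 + Real.log ((2 * (2 * 1122 + 1 : ℝ) ^ 4 * 65 ^ 4 * (4 * 2 ^ 4) + 4 * ((2 * 1122 + 1 : ℝ) ^ 4 * 5 ^ 4)) / (1 - 0.9799) +
          2 * (2 * ((2 * 1122 + 1 : ℝ) ^ 4 * 5 ^ 4))) +
        (0 + 3 * (2 * Real.log (2 * 4 + 1)) + 2 * (4 : ℝ) + 2 * Real.log (2 * 4 + 1) * (4 * 2 ^ 4) +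
          (4 : ℝ) * Real.log (2 * ((66 * ((2 * (2 * 1122 + 1 : ℝ) ^ 4 * 65 ^ 4 * (4 * 2 ^ 4) + 4 * ((2 * 1122 + 1 : ℝ) ^ 4 * 5 ^ 4)) / (1 - 0.9799)) +
            66 * (2 * ((2 * 1122 + 1 : ℝ) ^ 4 * 5 ^ 4)) + 1) * (1 + 4 * 2 ^ 4)) + 1)) +
        10) +
      8 * 2 ^ 4 * Real.log (2 * 4 + 1)) / 1) ^ ((23 : ℝ)⁻¹))) + 1) / 2) ∧
    Real.exp (-((max 1 ((
    ((1 + Real.log ((2 * (2 * 1122 + 1 : ℝ) ^ 4 * 65 ^ 4 * (4 * 2 ^ 4) + 4 * ((2 * 1122 + 1 : ℝ) ^ 4 * 5 ^ 4)) / (1 - 0.9799) +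
          2 * (2 * ((2 * 1122 + 1 : ℝ) ^ 4 * 5 ^ 4))) +
        (0 + 3 * (2 * Real.log (2 * 4 + 1)) + 2 * (4 : ℝ) + 2 * Real.log (2 * 4 + 1) * (4 * 2 ^ 4) +
          (4 : ℝ) * Real.log (2 * ((66 * ((2 * (2 * 1122 + 1 : ℝ) ^ 4 * 65 ^ 4 * (4 * 2 ^ 4) + 4 * ((2 * 1122 + 1 : ℝ) ^ 4 * 5 ^ 4)) / (1 - 0.9799)) +
            66 * (2 * ((2 * 1122 + 1 : ℝ) ^ 4 * 5 ^ 4)) + 1) * (1 + 4 * 2 ^ 4)) + 1)) +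
        10) +
      8 * 2 ^ 4 * Real.log (2 * 4 + 1)) / 1) ^ ((23 : ℝ)⁻¹))) + 1) / 2) ≤ 0.3097 :=
  ⟨window23_ge_of_le (le_trans (by norm_num) thetaJc_ge) thetaJc_le, window23_le_of_ge thetaJc_ge⟩

/-- **p₀ = 23 AT THE JENSEN-FORM CENSUS VALUE** (`thetaConcave_le : Θc₀ ≤ 874.7`): `0 ≤ Θ′ ≤ 874.7` ⇒
`0.3098 ≤ w(Θ′, 1, 23)` (root `≤ 1.343`, `0.3098 ≤ exp (−(1.343+1)∕2)`; engines 0.30998 at 874.63). [folklore] -/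
theorem window23_concave_ge {Θ : ℝ} (hΘ0 : 0 ≤ Θ) (hΘ : Θ ≤ 874.7) :
    (0.3098 : ℝ) ≤ Real.exp (-((max 1 ((Θ / 1) ^ ((23 : ℝ)⁻¹))) + 1) / 2) := by
  have hx : (Θ / 1) ^ ((23 : ℝ)⁻¹) ≤ 1.343 := by
    rw [div_one, show ((23 : ℝ)⁻¹) = ((23 : ℕ) : ℝ)⁻¹ by norm_num]
    exact rpow_inv_le_of_le_pow (by norm_num) (by norm_num) hΘ0 (hΘ.trans (by norm_num))
  have h := exp_le_of_taylor (x := (1.343 + 1 : ℝ) / 2) (r := 0.1715) 1 (by norm_num) (by norm_num) (by norm_num)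
  have hnum : (0.3098 : ℝ) ≤ Real.exp (-((1.343 + 1 : ℝ) / 2)) := by
    rw [Real.exp_neg, le_inv_comm₀ (by norm_num) (Real.exp_pos _)]
    norm_num at h ⊢
    linarith
  refine hnum.trans (Real.exp_le_exp.2 ?_)
  have : max 1 ((Θ / 1) ^ ((23 : ℝ)⁻¹)) ≤ 1.343 := max_le (by norm_num) hx
  linarith

end Column23

/-! ## §4 The p₀ = 2 column -/

section Column2
/-- **p₀ = 2, LOWER LINE**: `0 ≤ Θ ≤ 912.6` ⇒ `1.66·10⁻⁷ ≤ w(Θ, 1, 2)` (`912.6 ≤ 30.21²`; engines 1.6705·10⁻⁷). [folklore] -/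
theorem window2_ge_of_le {Θ : ℝ} (hΘ0 : 0 ≤ Θ) (hΘ : Θ ≤ 912.6) :
    (1.66e-7 : ℝ) ≤ Real.exp (-((max 1 ((Θ / 1) ^ ((2 : ℝ)⁻¹))) + 1) / 2) := by
  have hx : (Θ / 1) ^ ((2 : ℝ)⁻¹) ≤ 30.21 := by
    rw [div_one, show ((2 : ℝ)⁻¹) = ((2 : ℕ) : ℝ)⁻¹ by norm_num]
    exact rpow_inv_le_of_le_pow (by norm_num) (by norm_num) hΘ0 (hΘ.trans (by norm_num))
  have h := exp_le_of_taylor (x := (30.21 + 1 : ℝ) / 2) (r := 0.605) 15 (by norm_num) (by norm_num) (by norm_num)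
  have hnum : (1.66e-7 : ℝ) ≤ Real.exp (-((30.21 + 1 : ℝ) / 2)) := by
    rw [Real.exp_neg, le_inv_comm₀ (by norm_num) (Real.exp_pos _)]
    norm_num at h ⊢
    linarith
  refine hnum.trans (Real.exp_le_exp.2 ?_)
  have : max 1 ((Θ / 1) ^ ((2 : ℝ)⁻¹)) ≤ 30.21 := max_le (by norm_num) hx
  linarith

/-- **p₀ = 2, UPPER LINE**: `912.51 ≤ Θ` ⇒ `w(Θ, 1, 2) ≤ 1.68·10⁻⁷` (`30.207² ≤ 912.51`; engines 1.6730·10⁻⁷). [folklore] -/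
theorem window2_le_of_ge {Θ : ℝ} (hΘ : 912.51 ≤ Θ) :
    Real.exp (-((max 1 ((Θ / 1) ^ ((2 : ℝ)⁻¹))) + 1) / 2) ≤ 1.68e-7 := by
  have hx : (30.207 : ℝ) ≤ (Θ / 1) ^ ((2 : ℝ)⁻¹) := by
    rw [div_one, show ((2 : ℝ)⁻¹) = ((2 : ℕ) : ℝ)⁻¹ by norm_num]
    exact le_rpow_inv_of_pow_le (by norm_num) (by norm_num) (le_trans (by norm_num) hΘ)
  have h := le_exp_of_taylor (x := (30.207 + 1 : ℝ) / 2) (r := 0.6035) 15 (by norm_num) (by norm_num) (by norm_num)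
  have hnum : Real.exp (-((30.207 + 1 : ℝ) / 2)) ≤ 1.68e-7 := by
    rw [Real.exp_neg, inv_le_comm₀ (Real.exp_pos _) (by norm_num)]
    norm_num at h ⊢
    linarith
  refine (Real.exp_le_exp.2 ?_).trans hnum
  have : (30.207 : ℝ) ≤ max 1 ((Θ / 1) ^ ((2 : ℝ)⁻¹)) := hx.trans (le_max_right _ _)
  linarith

/-- **THE p₀ = 2 WINDOW AT THE LANDED CONSTANT: `1.66·10⁻⁷ ≤ w(ΘJc + 8·2⁴·log 9, 1, 2) ≤ 1.68·10⁻⁷`** (engines 1.6723·10⁻⁷);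
the census's «2.3·10⁻⁷» is the Jensen-form value's (`window2_concave_ge`). [folklore] -/
theorem window2_Jc :
    (1.66e-7 : ℝ) ≤ Real.exp (-((max 1 ((
    ((1 + Real.log ((2 * (2 * 1122 + 1 : ℝ) ^ 4 * 65 ^ 4 * (4 * 2 ^ 4) + 4 * ((2 * 1122 + 1 : ℝ) ^ 4 * 5 ^ 4)) / (1 - 0.9799) +
          2 * (2 * ((2 * 1122 + 1 : ℝ) ^ 4 * 5 ^ 4))) +
        (0 + 3 * (2 * Real.log (2 * 4 + 1)) + 2 * (4 : ℝ) + 2 * Real.log (2 * 4 + 1) * (4 * 2 ^ 4) +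
          (4 : ℝ) * Real.log (2 * ((66 * ((2 * (2 * 1122 + 1 : ℝ) ^ 4 * 65 ^ 4 * (4 * 2 ^ 4) + 4 * ((2 * 1122 + 1 : ℝ) ^ 4 * 5 ^ 4)) / (1 - 0.9799)) +
            66 * (2 * ((2 * 1122 + 1 : ℝ) ^ 4 * 5 ^ 4)) + 1) * (1 + 4 * 2 ^ 4)) + 1)) +
        10) +
      8 * 2 ^ 4 * Real.log (2 * 4 + 1)) / 1) ^ ((2 : ℝ)⁻¹))) + 1) / 2) ∧
    Real.exp (-((max 1 ((
    ((1 + Real.log ((2 * (2 * 1122 + 1 : ℝ) ^ 4 * 65 ^ 4 * (4 * 2 ^ 4) + 4 * ((2 * 1122 + 1 : ℝ) ^ 4 * 5 ^ 4)) / (1 - 0.9799) +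
          2 * (2 * ((2 * 1122 + 1 : ℝ) ^ 4 * 5 ^ 4))) +
        (0 + 3 * (2 * Real.log (2 * 4 + 1)) + 2 * (4 : ℝ) + 2 * Real.log (2 * 4 + 1) * (4 * 2 ^ 4) +
          (4 : ℝ) * Real.log (2 * ((66 * ((2 * (2 * 1122 + 1 : ℝ) ^ 4 * 65 ^ 4 * (4 * 2 ^ 4) + 4 * ((2 * 1122 + 1 : ℝ) ^ 4 * 5 ^ 4)) / (1 - 0.9799)) +
            66 * (2 * ((2 * 1122 + 1 : ℝ) ^ 4 * 5 ^ 4)) + 1) * (1 + 4 * 2 ^ 4)) + 1)) +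
        10) +
      8 * 2 ^ 4 * Real.log (2 * 4 + 1)) / 1) ^ ((2 : ℝ)⁻¹))) + 1) / 2) ≤ 1.68e-7 :=
  ⟨window2_ge_of_le (le_trans (by norm_num) thetaJc_ge) thetaJc_le, window2_le_of_ge thetaJc_ge⟩

/-- **p₀ = 2 AT THE JENSEN-FORM CENSUS VALUE** (`thetaConcave_le : Θc₀ ≤ 874.7`): `0 ≤ Θ′ ≤ 874.7` ⇒
`2.29·10⁻⁷ ≤ w(Θ′, 1, 2)` (`874.7 ≤ 29.576²`; engines 2.2956·10⁻⁷ at 874.63) — the census's «≈ 2.3·10⁻⁷». [folklore] -/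
theorem window2_concave_ge {Θ : ℝ} (hΘ0 : 0 ≤ Θ) (hΘ : Θ ≤ 874.7) :
    (2.29e-7 : ℝ) ≤ Real.exp (-((max 1 ((Θ / 1) ^ ((2 : ℝ)⁻¹))) + 1) / 2) := by
  have hx : (Θ / 1) ^ ((2 : ℝ)⁻¹) ≤ 29.576 := by
    rw [div_one, show ((2 : ℝ)⁻¹) = ((2 : ℕ) : ℝ)⁻¹ by norm_num]
    exact rpow_inv_le_of_le_pow (by norm_num) (by norm_num) hΘ0 (hΘ.trans (by norm_num))
  have h := exp_le_of_taylor (x := (29.576 + 1 : ℝ) / 2) (r := 0.288) 15 (by norm_num) (by norm_num) (by norm_num)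
  have hnum : (2.29e-7 : ℝ) ≤ Real.exp (-((29.576 + 1 : ℝ) / 2)) := by
    rw [Real.exp_neg, le_inv_comm₀ (by norm_num) (Real.exp_pos _)]
    norm_num at h ⊢
    linarith
  refine hnum.trans (Real.exp_le_exp.2 ?_)
  have : max 1 ((Θ / 1) ^ ((2 : ℝ)⁻¹)) ≤ 29.576 := max_le (by norm_num) hx
  linarith

end Column2

/-! ## §5 The tree-constant line (generic in Θ; compose with `thetaTree_gt`) -/

section TreeLine
/-- **THE TREE-CONSTANT LINE**: `1.31·10²⁷ ≤ Θ` ⇒ `w(Θ, 1, 23) ≤ 3.2·10⁻⁴` (`15.1²³ ≤ 1.31·10²⁷`, `exp (−(15.1+1)∕2) ≤ 3.2·10⁻⁴`;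
the tree-shape constant exceeds `1.5·10²⁷` by `thetaTree_gt`; engines: `2.6·10⁻⁴` at the full `2.36·10²⁷`). [folklore] -/
theorem window23_le_of_ge_tree {Θ : ℝ} (hΘ : 1.31e27 ≤ Θ) :
    Real.exp (-((max 1 ((Θ / 1) ^ ((23 : ℝ)⁻¹))) + 1) / 2) ≤ 3.2e-4 := by
  have hx : (15.1 : ℝ) ≤ (Θ / 1) ^ ((23 : ℝ)⁻¹) := by
    rw [div_one, show ((23 : ℝ)⁻¹) = ((23 : ℕ) : ℝ)⁻¹ by norm_num]
    exact le_rpow_inv_of_pow_le (by norm_num) (by norm_num) (le_trans (by norm_num) hΘ)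
  have h := le_exp_of_taylor (x := (15.1 + 1 : ℝ) / 2) (r := 0.05) 8 (by norm_num) (by norm_num) (by norm_num)
  have hnum : Real.exp (-((15.1 + 1 : ℝ) / 2)) ≤ 3.2e-4 := by
    rw [Real.exp_neg, inv_le_comm₀ (Real.exp_pos _) (by norm_num)]
    norm_num at h ⊢
    linarith
  refine (Real.exp_le_exp.2 ?_).trans hnum
  have : (15.1 : ℝ) ≤ max 1 ((Θ / 1) ^ ((23 : ℝ)⁻¹)) := hx.trans (le_max_right _ _)
  linarith

end TreeLine

/-! ## §6 The first factor on its explicit (root) road — leaf-01 g11's witness-letter rows (journal l.19771) -/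

section FirstFactor
/-- **`13 ≤ x ⇒ exp (−x∕2) ≤ 1.51·10⁻³`** (engines: e^{−6.5} = 1.5034·10⁻³) — the merger clause
`x_pay ≥ L·(14E₂∕A₀)^{1∕11}` of the root threshold at `L = 13`, `E₂∕A₀ = 1∕14`. [folklore] -/
theorem firstFactor_le_of_ge {x : ℝ} (hx : 13 ≤ x) : Real.exp (-x / 2) ≤ 1.51e-3 := by
  have h := le_exp_of_taylor (x := (13 : ℝ) / 2) (r := 0.5) 6 (by norm_num) (by norm_num) (by norm_num)
  have h13 : Real.exp (-((13 : ℝ) / 2)) ≤ 1.51e-3 := by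
    rw [Real.exp_neg, inv_le_comm₀ (Real.exp_pos _) (by norm_num)]
    norm_num at h ⊢
    linarith
  exact (Real.exp_le_exp.2 (by linarith)).trans h13

/-- **`16.52 ≤ 13·14^{1∕11}`** (engines: 16.5248; `16.52¹¹ ≤ 14·13¹¹`): the clause at `E₂ = A₀`. [folklore] -/
theorem payRoot_witness_ge : (16.52 : ℝ) ≤ 13 * (14 : ℝ) ^ ((11 : ℝ)⁻¹) := by
  have h : (16.52 / 13 : ℝ) ≤ (14 : ℝ) ^ ((11 : ℝ)⁻¹) := by
    rw [show ((11 : ℝ)⁻¹) = ((11 : ℕ) : ℝ)⁻¹ by norm_num]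
    exact le_rpow_inv_of_pow_le (by norm_num) (by norm_num) (by norm_num)
  linarith

/-- **`16.52 ≤ x ⇒ exp (−x∕2) ≤ 2.6·10⁻⁴`** (engines: 2.5804·10⁻⁴ at 16.5248). [folklore] -/
theorem firstFactor_le_of_ge' {x : ℝ} (hx : 16.52 ≤ x) : Real.exp (-x / 2) ≤ 2.6e-4 := by
  have h := le_exp_of_taylor (x := (16.52 : ℝ) / 2) (r := 0.26) 8 (by norm_num) (by norm_num) (by norm_num)
  have h16 : Real.exp (-((16.52 : ℝ) / 2)) ≤ 2.6e-4 := by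
    rw [Real.exp_neg, inv_le_comm₀ (Real.exp_pos _) (by norm_num)]
    norm_num at h ⊢
    linarith
  exact (Real.exp_le_exp.2 (by linarith)).trans h16

/-- the `E₂ = A₀` row assembled: **`exp (−13·14^{1∕11}∕2) ≤ 2.6·10⁻⁴`**. [folklore] -/
theorem firstFactor_witness_le : Real.exp (-(13 * (14 : ℝ) ^ ((11 : ℝ)⁻¹)) / 2) ≤ 2.6e-4 :=
  firstFactor_le_of_ge' payRoot_witness_ge

end FirstFactor

end Summit.QuantumFields.BalabanUV.T4Continuum.HistoryWindowNumerals
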